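import Summits.BirchSwinnertonDyer.BirchSwinnertonDyer.Theorems.ResidualThetaTransportAtTwoSignedMuSeedAtTwoPlusTiltRecursion
import Summits.BirchSwinnertonDyer.BirchSwinnertonDyer.Theorems.ResidualThetaTransportAtTwoSignedMuSeedAtTwoPlusTiltThreshold
import Summits.BirchSwinnertonDyer.BirchSwinnertonDyer.Theorems.ResidualThetaTransportAtTwoSignedMuSeedAtTwoPlusTiltCoboundary
import HarnessLib

/-!
# Seed crux `SignedMuSeedAtTwoPlus` (stmt-BirchSwinnertonDyer-21438), line `norm-field-tilt`:
# SOUNDNESS OF THE TILT ENGINE'S INFERENCE `NonDeg(m₀) ⟹ OddDigit(m)` for every `m ≥ m₀ + 2` (S2 ∘ S3, end to end)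

Cell `bsd-wall`, width seat `bsd-wall-rtt-p4-w2` g10; capstone of p656802 (`…TiltRecursion`, S2), p656963
(`…TiltThreshold`, S3 + `ℕ`-glue) and p657296 (`…TiltCoboundary`).  HONEST FRAMING: THEOREMS ONLY; pure power-series
algebra over a domain of characteristic `2`; closes no item; the line is NOT registered; BSD is NOT proved by this.

## What is proved

The line card reduces the fine half `(F)` of the seed, for a whole habitat⁺ class, to ONE finite-order condition
`NonDeg(m₀) : v(S_{m₀}) < 4^{m₀+1} − 2` by the chain «S2 recursion ⟹ `v(S_m) < 3·4^m − 2^{m+2}` for all large `m`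
⟹ (S3) an odd `s̄`-digit of `Z'_{ρ,m}` is non-zero».  `oddDigit_of_nonDeg` is that chain as ONE kernel theorem about
an abstract LEVEL STRUCTURE over a domain `k` of characteristic `2` — sequences `Z_m, S_m, y_m, r_m, s_m ∈ k⟦t⟧`,
`P_m ∈ k[X]` with:
`u' = 0` (`D = u·d/dt`, `D∘D = 0`); `Z_m ≠ 0`, `Z_m·S_m = D Z_m`; `S_{m+1} = S_m + S_m(t ⊕ y_m)` with
`t ⊕ y_m = t + u·y_m + y_m²·r_m`; `ord y_m = 4^{m+1}`; `ord Z_m = 2^{m+2}`; `Z_m ≡ P_m(s_m) (mod t^{3·4^m})`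
(the membership `Z'_{ρ,m} ∈ 𝔽₄[s̄] + (t̄^e)`, `e = 3·4^m`) — and the conclusion:
**`ord S_{m₀} = a₀` with `a₀ + 2 < 4^{m₀+1}` ⟹ for every `m ≥ m₀ + 2`, some odd-degree coefficient of `P_m` is
non-zero** (the threshold `m₀ + 2` is sharp in the `ℕ`-glue, see p656963).  `oddDigit_of_nonDeg_of_levelStep` takes
the level step at the `Z`-level (`Z_{m+1} = Z_m·Z_m(t ⊕ y_m)`, invariance `u·(t ⊕ y_m)' = u(t ⊕ y_m)`) instead, via
uniqueness of `D log`.  Auxiliary: `order_level_eq` (the valuations `v(S_{m₀+j})` ARE the `ℕ`-sequence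
`b₀ = a₀, b_{j+1} = 2b_j + 4^{m₀+j+1}`, all levels non-degenerate).

Inputs NOT discharged here (they are the line's stub S1 and the choice of class): the construction of `Z_m = Z'_{ρ,m}`
from Robert's function and the CM action, `ord Z_m = 2^{m+2}`, the membership, and `ord y_m = 4^{m+1}`
(`y_m = ([±v]t̄)^{4^{m+1}}`); and `NonDeg(m₀)` itself (stub S4, per class by the engine). [folklore]
-/

noncomputable section

set_option autoImplicit false
set_option linter.dupNamespace false

open PowerSeries

namespace Summit.BirchSwinnertonDyer.BirchSwinnertonDyer.Theorems.SignedMuAtTwo.Tilt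

variable {k : Type*} [CommRing k] [NoZeroDivisors k] [CharP k 2]

/-- The `ℕ`-sequence of valuations predicted by the recursion from level `m₀` on:
`b 0 = a₀`, `b (j+1) = 2·b j + 4^{m₀+j+1}` (written with `Nat.rec`, no definition introduced). [folklore] -/
theorem levelSeq_succ (a₀ m₀ j : ℕ) :
    (Nat.rec a₀ (fun j bj => 2 * bj + 4 ^ (m₀ + j + 1)) (j + 1) : ℕ) =
      2 * Nat.rec a₀ (fun j bj => 2 * bj + 4 ^ (m₀ + j + 1)) j + 4 ^ (m₀ + j + 1) := rfl

/-- **The valuations along the tower.**  Under the level structure (see the module docstring; only `u' = 0`,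
`Z_m ≠ 0`, `Z_m S_m = u Z_m'`, the `S`-level step, the translation shape and `ord y_m = 4^{m+1}` are used), if
`ord S_{m₀} = a₀` with `a₀ + 2 < 4^{m₀+1}` then for every `j`: `ord S_{m₀+j} = b_j` and `b_j + 2 < 4^{m₀+j+1}`,
where `b₀ = a₀`, `b_{j+1} = 2b_j + 4^{m₀+j+1}`. [folklore] -/
theorem order_level_eq {u : PowerSeries k} (hu : d⁄dX k u = 0) (Z S y r φ : ℕ → PowerSeries k)
    (hZ : ∀ m, Z m ≠ 0) (hZS : ∀ m, Z m * S m = u * d⁄dX k (Z m))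
    (hφ : ∀ m, φ m = X + u * y m + y m ^ 2 * r m)
    (hstep : ∀ m, S (m + 1) = S m + (S m).subst (φ m))
    (hy : ∀ m, (y m).order = (4 ^ (m + 1) : ℕ)) {m₀ a₀ : ℕ} (ha₀ : (S m₀).order = a₀)
    (hnd : a₀ + 2 < 4 ^ (m₀ + 1)) (j : ℕ) :
    (S (m₀ + j)).order = (Nat.rec a₀ (fun j bj => 2 * bj + 4 ^ (m₀ + j + 1)) j : ℕ) ∧
      (Nat.rec a₀ (fun j bj => 2 * bj + 4 ^ (m₀ + j + 1)) j : ℕ) + 2 < 4 ^ (m₀ + j + 1) := by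
  induction j with
  | zero => exact ⟨by simpa using ha₀, by simpa using hnd⟩
  | succ j ih =>
    obtain ⟨hord, hndj⟩ := ih
    set b := (Nat.rec a₀ (fun j bj => 2 * bj + 4 ^ (m₀ + j + 1)) j : ℕ) with hb
    have hrec : (S (m₀ + (j + 1))).order = (2 * b + 4 ^ (m₀ + j + 1) : ℕ) := by
      rw [← add_assoc, hstep]
      exact tiltRecursion_step hu (hZ _) (hZS _) (hφ _) hord (hy _) hndj
    refine ⟨by rw [hrec, levelSeq_succ], ?_⟩
    rw [levelSeq_succ, ← hb]
    have e1 : (4 : ℕ) ^ (m₀ + (j + 1) + 1) = 4 * 4 ^ (m₀ + j + 1) := by rw [← add_assoc, pow_succ]; ring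
    rw [e1]
    omega

/-- **Soundness of the tilt engine's inference (S2 ∘ S3, end to end).**  Over a domain `k` of characteristic `2`
with a level structure as in the module docstring: `ord S_{m₀} = a₀`, `a₀ + 2 < 4^{m₀+1}` (`NonDeg(m₀)`) ⟹ for every
`m ≥ m₀ + 2` the polynomial `P_m` (the `s̄`-digits of `Z_m mod t^{3·4^m}`) has a non-zero ODD-degree coefficient.
[folklore] -/
theorem oddDigit_of_nonDeg {u : PowerSeries k} (hu : d⁄dX k u = 0) (Z S y r φ s : ℕ → PowerSeries k)
    (P : ℕ → Polynomial k)
    (hZ : ∀ m, Z m ≠ 0) (hZS : ∀ m, Z m * S m = u * d⁄dX k (Z m))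
    (hφ : ∀ m, φ m = X + u * y m + y m ^ 2 * r m)
    (hstep : ∀ m, S (m + 1) = S m + (S m).subst (φ m))
    (hy : ∀ m, (y m).order = (4 ^ (m + 1) : ℕ))
    (hZord : ∀ m, (Z m).order = (2 ^ (m + 2) : ℕ))
    (hmem : ∀ m, (X : PowerSeries k) ^ (3 * 4 ^ m) ∣ Z m - Polynomial.aeval (s m) (P m))
    {m₀ a₀ : ℕ} (ha₀ : (S m₀).order = a₀) (hnd : a₀ + 2 < 4 ^ (m₀ + 1))
    {m : ℕ} (hm : m₀ + 2 ≤ m) : ∃ i, Odd i ∧ (P m).coeff i ≠ 0 := by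
  -- the `ℕ`-sequence of valuations and the threshold `b + 2^{m+2} < 3·4^m` for `m ≥ m₀ + 2`
  set a : ℕ → ℕ := fun n => Nat.rec a₀ (fun j bj => 2 * bj + 4 ^ (m₀ + j + 1)) (n - m₀) with ha
  have hrecN : ∀ n, m₀ ≤ n → a n + 2 < 4 ^ (n + 1) → a (n + 1) = 2 * a n + 4 ^ (n + 1) := by
    intro n hn _
    simp only [ha]
    rw [show n + 1 - m₀ = (n - m₀) + 1 by omega, levelSeq_succ, show m₀ + (n - m₀) + 1 = n + 1 by omega]
  have h₀ : a m₀ + 2 < 4 ^ (m₀ + 1) := by simpa [ha] using hnd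
  obtain ⟨j, rfl⟩ : ∃ j, m = m₀ + 2 + j := ⟨m - (m₀ + 2), by omega⟩
  have hthr := tiltRecursion_threshold a m₀ hrecN h₀ j
  have haj : a (m₀ + 2 + j) = (Nat.rec a₀ (fun j bj => 2 * bj + 4 ^ (m₀ + j + 1)) (2 + j) : ℕ) := by
    simp only [ha]; rw [show m₀ + 2 + j - m₀ = 2 + j by omega]
  -- the valuation of `S_m`
  have hS := (order_level_eq hu Z S y r φ hZ hZS hφ hstep hy ha₀ hnd (2 + j)).1
  rw [← add_assoc] at hS
  rw [haj] at hthr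
  -- S3 in `D log` currency: `ord Z_m + ord S_m = 2^{m+2} + b < 3·4^m = e`
  refine exists_odd_coeff_ne_zero_of_order_add_order_lt (e := 3 * 4 ^ (m₀ + 2 + j)) ?_ (hZS _) (hmem _) ?_
  · rw [show m₀ + 2 + j = (m₀ + 1 + j) + 1 by ring, pow_succ]
    exact ⟨3 * 4 ^ (m₀ + 1 + j) * 2, by ring⟩
  · rw [hZord, hS]
    rw [add_comm] at hthr
    exact_mod_cast hthr

/-- **The same with the level step at the `Z`-level**, as the line has it: `Z_{m+1} = Z_m·Z_m(t ⊕ y_m)` (one more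
orbit factor) and the translations preserve `dt/u` (`u·(t ⊕ y_m)' = u(t ⊕ y_m)`); then `S_{m+1} = S_m + S_m(t ⊕ y_m)`
is forced (`logDeriv_levelStep` + uniqueness of `D log`), and `NonDeg(m₀) ⟹ OddDigit(m)` for all `m ≥ m₀ + 2`.
[folklore] -/
theorem oddDigit_of_nonDeg_of_levelStep {u : PowerSeries k} (hu : d⁄dX k u = 0)
    (Z S y r φ s : ℕ → PowerSeries k) (P : ℕ → Polynomial k)
    (hZ : ∀ m, Z m ≠ 0) (hZS : ∀ m, Z m * S m = u * d⁄dX k (Z m))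
    (hφ : ∀ m, φ m = X + u * y m + y m ^ 2 * r m)
    (hinv : ∀ m, u * d⁄dX k (φ m) = u.subst (φ m))
    (hZstep : ∀ m, Z (m + 1) = Z m * (Z m).subst (φ m))
    (hy : ∀ m, (y m).order = (4 ^ (m + 1) : ℕ))
    (hZord : ∀ m, (Z m).order = (2 ^ (m + 2) : ℕ))
    (hmem : ∀ m, (X : PowerSeries k) ^ (3 * 4 ^ m) ∣ Z m - Polynomial.aeval (s m) (P m))
    {m₀ a₀ : ℕ} (ha₀ : (S m₀).order = a₀) (hnd : a₀ + 2 < 4 ^ (m₀ + 1))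
    {m : ℕ} (hm : m₀ + 2 ≤ m) : ∃ i, Odd i ∧ (P m).coeff i ≠ 0 := by
  have hφ0 : ∀ n, constantCoeff (φ n) = 0 := fun n => by
    have h1 : (1 : ℕ∞) ≤ (y n).order := by
      rw [hy]; exact_mod_cast Nat.one_le_pow _ _ (by norm_num)
    have hy0 : constantCoeff (y n) = 0 := by
      have := coeff_of_lt_order (φ := y n) 0 (lt_of_lt_of_le (by norm_num) h1)
      rwa [coeff_zero_eq_constantCoeff_apply] at this
    rw [hφ]; simp [hy0]
  have hstep : ∀ n, S (n + 1) = S n + (S n).subst (φ n) := fun n =>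
    logDeriv_unique (hZ (n + 1)) (hZS (n + 1))
      (by rw [hZstep]; exact logDeriv_levelStep (hφ0 n) (hinv n) (hZS n))
  exact oddDigit_of_nonDeg hu Z S y r φ s P hZ hZS hφ hstep hy hZord hmem ha₀ hnd hm

end Summit.BirchSwinnertonDyer.BirchSwinnertonDyer.Theorems.SignedMuAtTwo.Tilt

end
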